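import Literature.MathematicalPhysics.QuantumManyBody.BoseGasHardSet
import Literature.Analysis.Calculus.PolarCoordinatesE3
import HarnessLib

/-!
# Hard radii are radii of one-dimensional non-integrability

Topic `Literature/MathematicalPhysics/QuantumManyBody`, sequel of `BoseGasHardSet.lean` (hard set `hardVec v`, hard radii
`hardRad v` of a pair potential `v : ℝ → [0, ∞]`). The hard radii were defined through THREE-dimensional
non-integrability of `w ↦ v(|w|)` near the sphere of radius `r`; for the one-dimensional arguments along lines of the
form-core theorem for hard-core pair potentials (vanishing of finite-energy Sobolev functions at every hard sphere) one
needs the one-dimensional reading: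

* `ballIntegral_smul_unitE_le` — the shell bound `∫_{B(r₀e₀, ε)} v(|w|) dw ≤ σ(S²) (r₀+ε)² ∫_{(r₀-ε, r₀+ε)} v(r) dr`
  (polar coordinates, `Literature.Analysis.Calculus.lintegral_radial_eq`);
* `lintegral_Ioo_eq_top_of_mem_hardRad` — **if `r₀` is a hard radius then `∫_{(r₀-ε, r₀+ε)} v = ∞` for every `ε > 0`.**

Tagged folklore; physical context [LSSY2005] Ch. 2, (2.1).
-/

noncomputable section

open MeasureTheory Set Metric
open scoped ENNReal

namespace Literature.MathematicalPhysics.QuantumManyBody.BoseGas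

variable {v : ℝ → ℝ≥0∞}

/-- The surface measure of the unit sphere of `ℝ³` is finite. [folklore] -/
theorem toSphere_univ_lt_top : (volume : Measure Space).toSphere univ < ⊤ := by
  rw [Measure.toSphere_apply_univ]
  exact ENNReal.mul_lt_top (by simp) measure_ball_lt_top

/-- **Shell bound.** For `r₀ ≥ 0` and any `ε`, the ball `B(r₀ e₀, ε)` lies in the spherical shell `|w| ∈ (r₀-ε, r₀+ε)`,
whence by polar coordinates `∫_{B(r₀e₀, ε)} v(|w|) dw ≤ σ(S²) · (r₀+ε)² · ∫_{(r₀-ε, r₀+ε)} v(r) dr`. [folklore] -/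
theorem ballIntegral_smul_unitE_le (hv : Measurable v) {r₀ ε : ℝ} (hr₀ : 0 ≤ r₀) :
    ballIntegral v (r₀ • unitE) ε ≤ (volume : Measure Space).toSphere univ * ENNReal.ofReal ((r₀ + ε) ^ 2) *
      ∫⁻ r in Ioo (r₀ - ε) (r₀ + ε), v r := by
  set F : ℝ → ℝ≥0∞ := (Ioo (r₀ - ε) (r₀ + ε)).indicator v with hF
  have hFm : Measurable F := hv.indicator measurableSet_Ioo
  -- on the ball the integrand is the shell-truncated one
  have hball : ∀ w ∈ ball (r₀ • unitE) ε, v ‖w‖ = F ‖w‖ := by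
    intro w hw
    rw [hF, indicator_of_mem]
    rw [mem_ball, dist_eq_norm] at hw
    have h1 : |‖w‖ - r₀| < ε := by
      calc |‖w‖ - r₀| = |‖w‖ - ‖r₀ • unitE‖| := by rw [norm_smul_unitE hr₀]
        _ ≤ ‖w - r₀ • unitE‖ := abs_norm_sub_norm_le _ _
        _ < ε := hw
    rw [mem_Ioo]
    constructor <;> linarith [(abs_lt.1 h1).1, (abs_lt.1 h1).2]
  calc ballIntegral v (r₀ • unitE) ε = ∫⁻ w in ball (r₀ • unitE) ε, F ‖w‖ :=
        setLIntegral_congr_fun measurableSet_ball hball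
    _ ≤ ∫⁻ w, F ‖w‖ := setLIntegral_le_lintegral _ _
    _ = (volume : Measure Space).toSphere univ * ∫⁻ r in Ioi (0 : ℝ), F r * ENNReal.ofReal (r ^ 2) :=
        Literature.Analysis.Calculus.lintegral_radial_eq F hFm
    _ ≤ (volume : Measure Space).toSphere univ *
          ∫⁻ r in Ioi (0 : ℝ), (Ioo (r₀ - ε) (r₀ + ε)).indicator (fun r => v r * ENNReal.ofReal ((r₀ + ε) ^ 2)) r := by
        gcongr with r
        rw [hF]
        by_cases hr : r ∈ Ioo (r₀ - ε) (r₀ + ε)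
        · rw [indicator_of_mem hr, indicator_of_mem hr]
          exact mul_le_mul_right (ENNReal.ofReal_le_ofReal (sq_le_sq' (by linarith [hr.1]) hr.2.le)) _
        · rw [indicator_of_notMem hr, indicator_of_notMem hr, zero_mul]
    _ ≤ (volume : Measure Space).toSphere univ *
          ∫⁻ r, (Ioo (r₀ - ε) (r₀ + ε)).indicator (fun r => v r * ENNReal.ofReal ((r₀ + ε) ^ 2)) r := by
        gcongr
        exact Measure.restrict_le_self
    _ = (volume : Measure Space).toSphere univ * (ENNReal.ofReal ((r₀ + ε) ^ 2) * ∫⁻ r in Ioo (r₀ - ε) (r₀ + ε), v r) := by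
        rw [lintegral_indicator measurableSet_Ioo, lintegral_mul_const _ hv, mul_comm (ENNReal.ofReal _)]
    _ = _ := by rw [mul_assoc]

/-- **Hard radii are radii of one-dimensional non-integrability**: if `r₀ ∈ hardRad v` then
`∫_{(r₀-ε, r₀+ε)} v(r) dr = ∞` for every `ε > 0` (else the shell bound would make a ball around `r₀ e₀` integrable).
[folklore] -/
theorem lintegral_Ioo_eq_top_of_mem_hardRad (hv : Measurable v) {r₀ : ℝ} (h : r₀ ∈ hardRad v) {ε : ℝ} (hε : 0 < ε) :
    ∫⁻ r in Ioo (r₀ - ε) (r₀ + ε), v r = ⊤ := by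
  by_contra hfin
  have hball : ballIntegral v (r₀ • unitE) ε = ⊤ := h.2 ε hε
  have hle := ballIntegral_smul_unitE_le (ε := ε) hv h.1
  rw [hball, top_le_iff] at hle
  exact ENNReal.mul_ne_top (ENNReal.mul_ne_top toSphere_univ_lt_top.ne ENNReal.ofReal_ne_top) hfin hle

/-- Contrapositive form: a radius `r₀ ≥ 0` near which `v` is integrable (in one dimension) is not a hard radius. [folklore] -/
theorem not_mem_hardRad_of_lintegral_Ioo_ne_top (hv : Measurable v) {r₀ ε : ℝ} (hε : 0 < ε)
    (hfin : ∫⁻ r in Ioo (r₀ - ε) (r₀ + ε), v r ≠ ⊤) : r₀ ∉ hardRad v :=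
  fun h => hfin (lintegral_Ioo_eq_top_of_mem_hardRad hv h hε)

end Literature.MathematicalPhysics.QuantumManyBody.BoseGas

end
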